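import Mathlib
import Summits.Ventures.DiscreteObjects.Mahler.OddCoefficientsMahlerBound

/-!
# The published form of the Borwein–Dobrowolski–Mossinghoff odd-coefficient bound, discharged (venture `DiscreteObjects`, target L)

Cell `pub-namedobj`, seat `pub-namedobj-mahler` (gen 8). Framing: lottery ticket; floor = certified
bounds/negative ranges.

The Literature folder types [McKee–Smyth, Prop. 11.3] as `OddCoefficientsMahlerBound` ("`M(P) ≥ 5^{1/4}`"),
which is stronger than what its source [BDM07, Cor. 3.4] proves.  Here we state Corollary 3.4 of
[BDM07] VERBATIM (logarithmic form, `n - 1 = deg f`) as a named fact and discharge it with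
`OddCoefficientsMahlerBound.log_intMahlerMeasure_ge_of_odd`.
-/

namespace Summit.Ventures.DiscreteObjects.Mahler

open Polynomial

/-- **Odd-coefficient Mahler-measure bound, as published** [cite: BorweinDobrowolskiMossinghoff2007, Corollary 3.4 p.355] [file NumberTheory/MahlerMeasure/OddCoefficientsBound]:
"Let `f` be a polynomial with degree `n - 1` having odd coefficients and no cyclotomic factors. Then
`log M(f) ≥ (log 5 / 4)(1 - 1/n)`" (equality iff `f = ±1`).  *No cyclotomic factors* is expressed as
`Φ_m ∤ f` for every `m ≥ 1`; `M` is Mathlib's `Polynomial.mahlerMeasure` of the image over `ℂ`. -/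
def OddCoefficientsMahlerMeasureLogBound : Prop :=
  ∀ f : ℤ[X], (∀ i ≤ f.natDegree, Odd (f.coeff i)) → (∀ m : ℕ, 0 < m → ¬ cyclotomic m ℤ ∣ f) →
    Real.log 5 / 4 * (1 - 1 / ((f.natDegree : ℝ) + 1)) ≤ Real.log ((f.map (Int.castRingHom ℂ)).mahlerMeasure)

/-- **[BDM07, Cor. 3.4] holds** (kernel proof: `OddCoefficientsMahlerBound`). -/
theorem oddCoefficientsMahlerMeasureLogBound_holds : OddCoefficientsMahlerMeasureLogBound :=
  fun _ hodd hcf => log_intMahlerMeasure_ge_of_odd hodd hcf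

end Summit.Ventures.DiscreteObjects.Mahler
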